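import Summits.BirchSwinnertonDyer.BirchSwinnertonDyer.Theses.ThetaPartnerAtTwo
import HarnessLib

/-!
# Route `ThetaPartnerAtTwo` (TP2) — glue of the KZ-window split of K3P′ `SignedKatoDivisibilityUpToAtTwoOfPub`
# (stmt-BirchSwinnertonDyer-25631, gen 1, route rev 47): item stmt-BirchSwinnertonDyer-22682 `SignedKatoDivisibilityUpToAtTwoOfPubGlue`

HONEST FRAMING (cell `pub/bsd-wall`, W-ALL row 1 TP2 K3 column; lead prover `bsd-wall-tp2-p2x` g11).
Pure glue, the `fun hH hC => hC hH` term certified by the pen (bsd-wall-p2 g17, cert K3ctxTP2.lean): the children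
H `KatoEulerSystemTatePairingValuesTwoInput` (stmt-…-22680, HOLD = the published input
`Kato2004.exists_eulerSystem_expStar_tatePairing_values_two`: Kato 2004 Thm. 12.5 (1) + explicit reciprocity at `2`,
Rubin 1998 §5, Kobayashi 2003 (8.23)) and C `SignedKatoDivisibilityUpToAtTwoOfPubOfKatoFact` (stmt-…-22681, := H → K3P′)
give the parent K3P′. Nothing is proved about any curve here; H stays a HOLD; K3 / K3P′ are NOT settled by this;
BSD is NOT proved by any of this.
-/

set_option autoImplicit false
-- the Theorems namespace of this sub repeats the summit name by design (D-0017 nested layout)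
set_option linter.dupNamespace false

namespace Summit.BirchSwinnertonDyer.BirchSwinnertonDyer.Theorems

/-- **Glue 22682 BY NAME**: `KatoEulerSystemTatePairingValuesTwoInput → SignedKatoDivisibilityUpToAtTwoOfPubOfKatoFact →
SignedKatoDivisibilityUpToAtTwoOfPub` — modus ponens. [cite: Kato2004Asterisque, Thm. 12.5 (1) (pp. 221–222), Thm. 13.4 (2) (p. 226)]
[cite: Kobayashi2003, (8.23), Prop. 8.25] -/
theorem signedKatoDivisibilityUpToAtTwoOfPubGlue_proof :
    Summit.BirchSwinnertonDyer.BirchSwinnertonDyer.Theses.ThetaPartnerAtTwo.SignedKatoDivisibilityUpToAtTwoOfPubGlue := by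
  unfold Summit.BirchSwinnertonDyer.BirchSwinnertonDyer.Theses.ThetaPartnerAtTwo.SignedKatoDivisibilityUpToAtTwoOfPubGlue
    Summit.BirchSwinnertonDyer.BirchSwinnertonDyer.Theses.ThetaPartnerAtTwo.SignedKatoDivisibilityUpToAtTwoOfPubOfKatoFact
  intro hH hC
  exact hC hH

end Summit.BirchSwinnertonDyer.BirchSwinnertonDyer.Theorems
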